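import Mathlib
import Summits.ValiantsHypothesis.ValiantsHypothesis.Theorems.NewtonUnitEquationsTwoProductsPlanarCellDissociated
import HarnessLib

/-!
# Crux `TwoProducts` (stmt-ValiantsHypothesis-5906), planar cells in the DISSOCIATED regime: at most `2m + 2` visible points
# per cell (LINEAR in `m`) — the superset argument

Theory lane (val-lit-p3 g13, CLAIM-FIRST #5; sharpens `planarCell_dissociated`, p602891, from `2^m` to `2m + 2`).  Same setting:
tails supported in `A_j ∌ 0` with the sum map injective on `∏_j (A_j ∪ {0})`, one weight-order cell.

THE SUPERSET ARGUMENT.  A visible point `l` has a unique letter tuple `a`; write `F(a) = ∏ û_j(a_j)`, `G(a) = ∏ v̂_j(a_j)`, so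
`W[l] = F(a) − G(a) ≠ 0`.  Call a position `j` IMPROVABLE for `l` (relative to the class `F ≠ 0`) if some visible point of the
class carries a STRICTLY heavier letter `p` in slot `j`.  Replacing letters of `a` by heavier visible letters gives tuples whose
points outweigh `l` for `l`'s witness, hence are cancelled: `F = G` there.  Two improvable positions `j ≠ j'` give the three
cancelled tuples `a⁺ʲ, a⁺ʲ', a⁺ʲʲ'`, and the rank-one identities `F(a)F(a⁺ʲʲ') = F(a⁺ʲ)F(a⁺ʲ')` (same for `G`) force `F(a) = G(a)`
when `F(a⁺ʲʲ') ≠ 0` — which holds inside the class `F ≠ 0`.  So each point of the class has AT MOST ONE improvable position, and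
since two distinct visible points never dominate each other letterwise, the map "point ↦ its improvable position" is injective:
the class has `≤ m + 1` points (`card_filter_prod_ne_zero_le`).  The two classes `F ≠ 0`, `G ≠ 0` cover the cell:
`#S ≤ 2m + 2` (`planarCell_dissociated_linear`).  No rank, no linear independence, no Turán: ALL cancelled supersets are used,
not one cross point per pair — the form in which the argument can charge additive coincidences point by point (NOTE §15).

Honest framing: dissociated regime only (already polynomial in the tree by other routes); `PlanarCross`, `PlanarCellBound`, the
engine and the crux `TwoProducts` are OPEN; `VP ≠ VNP` is NOT proved.  No named facts. [folklore]
-/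

noncomputable section

-- Sub = Summit single-conjunct layout: the duplicated namespace component is mandated by the tree.
set_option linter.dupNamespace false

open scoped BigOperators
open MvPolynomial
open Summit.ValiantsHypothesis.ValiantsHypothesis.Theorems.NewtonUnitEquations.TwoProducts.FormalLogLinearisation

namespace Summit.ValiantsHypothesis.ValiantsHypothesis.Theorems.NewtonUnitEquations.TwoProducts.PlanarCell

variable {m : ℕ}

/-- Splitting a product over `Fin m` at two distinct indices. [folklore] -/
theorem prod_eq_mul_mul_prod_erase_erase (h : Fin m → ℂ) {j j' : Fin m} (hjj : j ≠ j') :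
    ∏ i, h i = h j * h j' * ∏ i ∈ (Finset.univ.erase j).erase j', h i := by
  classical
  rw [← Finset.mul_prod_erase _ _ (Finset.mem_univ j),
    ← Finset.mul_prod_erase _ _ (Finset.mem_erase.2 ⟨hjj.symm, Finset.mem_univ j'⟩), mul_assoc]

/-- **Rank-one identity for two letter updates:** `F(a)·F(a⁺ʲʲ') = F(a⁺ʲ)·F(a⁺ʲ')` for `F(t) = ∏_i h_i(t_i)`. [folklore] -/
theorem prod_mul_prod_update_update (h : Fin m → Expo → ℂ) (a : Fin m → Expo) {j j' : Fin m} (hjj : j ≠ j')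
    (p p' : Expo) :
    (∏ i, h i (a i)) * ∏ i, h i (Function.update (Function.update a j p) j' p' i) =
      (∏ i, h i (Function.update a j p i)) * ∏ i, h i (Function.update a j' p' i) := by
  classical
  have split : ∀ t : Fin m → Expo, ∏ i, h i (t i) =
      h j (t j) * h j' (t j') * ∏ i ∈ (Finset.univ.erase j).erase j', h i (t i) := fun t =>
    prod_eq_mul_mul_prod_erase_erase (fun i => h i (t i)) hjj
  have rest : ∀ (t : Fin m → Expo) (k : Fin m) (q : Expo), k = j ∨ k = j' →
      ∏ i ∈ (Finset.univ.erase j).erase j', h i (Function.update t k q i) =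
        ∏ i ∈ (Finset.univ.erase j).erase j', h i (t i) := by
    intro t k q hk
    refine Finset.prod_congr rfl fun i hi => ?_
    have hij' : i ≠ j' := Finset.ne_of_mem_erase hi
    have hij : i ≠ j := Finset.ne_of_mem_erase (Finset.mem_of_mem_erase hi)
    have hik : i ≠ k := by rcases hk with rfl | rfl <;> assumption
    rw [Function.update_of_ne hik]
  rw [split a, split (Function.update (Function.update a j p) j' p'), split (Function.update a j p),
    split (Function.update a j' p'), rest (Function.update a j p) j' p' (Or.inr rfl), rest a j p (Or.inl rfl),
    rest a j' p' (Or.inr rfl)]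
  simp only [Function.update_self, Function.update_of_ne hjj, Function.update_of_ne hjj.symm]
  ring

/-- **DISSOCIATED ⇒ AT MOST `2m + 2` VISIBLE POINTS PER CELL.**  Same hypotheses as `planarCell_dissociated`; the bound is
linear in `m` (superset argument). [folklore] -/
theorem planarCell_dissociated_linear (u v : Fin m → MvPolynomial (Fin 2) ℂ) (A : Fin m → Finset Expo)
    (hA0 : ∀ j, (0 : Expo) ∉ A j) (huA : ∀ j, (u j).support ⊆ A j) (hvA : ∀ j, (v j).support ⊆ A j)
    (hdis : Set.InjOn (fun a : Fin m → Expo => ∑ j, a j) ↑(Fintype.piFinset (fun j => insert 0 (A j))))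
    (R : Expo → Expo → Prop) (S : Finset Expo)
    (hS : ∀ l ∈ S, ∃ ξ : Fin 2 → ℝ, ValidWeight u v ξ ∧ IsStrictTop ξ (logSupport u v) l ∧
      ∀ e ∈ tailSupport u v, ∀ e' ∈ tailSupport u v, (R e e' ↔ wt ξ e ≤ wt ξ e')) :
    S.card ≤ 2 * m + 2 := by
  set PF := Fintype.piFinset (fun j => insert (0 : Expo) (A j)) with hPF
  set T := tailSupport u v with hT
  have hu0 : ∀ j, coeff 0 (u j) = 0 := fun j => notMem_support_iff.1 fun h => hA0 j (huA j h)
  have hv0 : ∀ j, coeff 0 (v j) = 0 := fun j => notMem_support_iff.1 fun h => hA0 j (hvA j h)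
  rcases S.eq_empty_or_nonempty with hS0 | ⟨l₀, hl₀⟩
  · simp [hS0]
  obtain ⟨ζ, hζval, -, hRζ⟩ := hS l₀ hl₀
  choose! ξ hval htop hRξ using hS
  have htopW : ∀ l ∈ S, IsStrictTop (ξ l) ↑(tailDiff u v).support l := fun l hl =>
    (stub_logLinearisation m u v hu0 hv0 (ξ l) (hval l hl) l).2 (htop l hl)
  have hsupp : ∀ l ∈ S, l ∈ (tailDiff u v).support := fun l hl => (htopW l hl).1
  -- coefficients of `W` on the image of the sum map, and vanishing off it
  have hW : tailDiff u v = ∏ j, (1 + u j) - ∏ j, (1 + v j) := rfl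
  have hcoeffW : ∀ a ∈ PF, coeff (∑ j, a j) (tailDiff u v) =
      ∏ j, hatCoeff (u j) (a j) - ∏ j, hatCoeff (v j) (a j) := by
    intro a ha
    rw [hW, coeff_sub, coeff_prod_one_add_of_mem u A hA0 huA hdis ha, coeff_prod_one_add_of_mem v A hA0 hvA hdis ha]
  have hcoeffW0 : ∀ p : Expo, (∀ a ∈ PF, ∑ j, a j ≠ p) → coeff p (tailDiff u v) = 0 := by
    intro p hp
    rw [hW, coeff_sub, coeff_prod_one_add_eq_zero u A hA0 huA hp, coeff_prod_one_add_eq_zero v A hA0 hvA hp, sub_zero]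
  -- representatives of the visible points
  have hrep : ∀ l ∈ S, ∃ a ∈ PF, ∑ j, a j = l := by
    intro l hl
    by_contra h
    exact (mem_support_iff.1 (hsupp l hl)) (hcoeffW0 l fun a ha heq => h ⟨a, ha, heq⟩)
  choose! rep hrepPF hrepsum using hrep
  -- letters of visible points are `0` or tail exponents
  have hT_of : ∀ (w : Fin m → MvPolynomial (Fin 2) ℂ) (i : Fin m) (e : Expo), (w = u ∨ w = v) →
      hatCoeff (w i) e ≠ 0 → e = 0 ∨ e ∈ T := by
    intro w i e hw hne
    by_cases he : e = 0
    · exact Or.inl he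
    · right
      simp only [hatCoeff, he, if_false] at hne
      have hmem : e ∈ (w i).support := mem_support_iff.2 hne
      rcases hw with rfl | rfl
      · exact Finset.mem_union_left _ (Finset.mem_biUnion.2 ⟨i, Finset.mem_univ _, hmem⟩)
      · exact Finset.mem_union_right _ (Finset.mem_biUnion.2 ⟨i, Finset.mem_univ _, hmem⟩)
  have hletter : ∀ l ∈ S, ∀ i, rep l i = 0 ∨ rep l i ∈ T := by
    intro l hl i
    have hne : coeff l (tailDiff u v) ≠ 0 := mem_support_iff.1 (hsupp l hl)
    rw [← hrepsum l hl, hcoeffW _ (hrepPF l hl)] at hne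
    by_cases hu : ∏ j, hatCoeff (u j) (rep l j) = 0
    · rw [hu, zero_sub, neg_ne_zero] at hne
      exact hT_of v i _ (Or.inr rfl) (Finset.prod_ne_zero_iff.1 hne i (Finset.mem_univ _))
    · exact hT_of u i _ (Or.inl rfl) (Finset.prod_ne_zero_iff.1 hu i (Finset.mem_univ _))
  -- comparisons of letters transfer from `ζ` to every witness, `0` on top
  have hwt0 : ∀ (η : Fin 2 → ℝ), wt η 0 = 0 := fun η => by simp [wt]
  have hval_neg : ∀ l ∈ S, ∀ e ∈ T, wt (ξ l) e < 0 := by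
    intro l hl e he
    rcases Finset.mem_union.1 he with h | h
    · obtain ⟨j, -, hj⟩ := Finset.mem_biUnion.1 h
      exact (hval l hl).1 j e hj
    · obtain ⟨j, -, hj⟩ := Finset.mem_biUnion.1 h
      exact (hval l hl).2 j e hj
  have hζ_neg : ∀ e ∈ T, wt ζ e < 0 := by
    intro e he
    rcases Finset.mem_union.1 he with h | h
    · obtain ⟨j, -, hj⟩ := Finset.mem_biUnion.1 h
      exact hζval.1 j e hj
    · obtain ⟨j, -, hj⟩ := Finset.mem_biUnion.1 h
      exact hζval.2 j e hj
  have transfer : ∀ l ∈ S, ∀ p q : Expo, (p = 0 ∨ p ∈ T) → (q = 0 ∨ q ∈ T) →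
      wt ζ q ≤ wt ζ p → wt (ξ l) q ≤ wt (ξ l) p := by
    intro l hl p q hp hq hle
    rcases hp with rfl | hp
    · rcases hq with rfl | hq
      · exact le_rfl
      · rw [hwt0]; exact (hval_neg l hl q hq).le
    · rcases hq with rfl | hq
      · exfalso
        rw [hwt0] at hle
        linarith [hζ_neg p hp]
      · exact (hRξ l hl q hq p hp).1 ((hRζ q hq p hp).2 hle)
  -- the weight of a visible point is the sum of the weights of its letters
  have hwt_rep : ∀ (η : Fin 2 → ℝ), ∀ l ∈ S, wt η l = ∑ j, wt η (rep l j) := by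
    intro η l hl
    conv_lhs => rw [← hrepsum l hl]
    exact wt_sum η _ _
  -- an updated tuple with heavier visible letters is cancelled
  have hPFupd : ∀ l ∈ S, ∀ l₁ ∈ S, ∀ j, Function.update (rep l) j (rep l₁ j) ∈ PF := by
    intro l hl l₁ hl₁ j
    rw [hPF, Fintype.mem_piFinset]
    intro i
    by_cases hi : i = j
    · subst hi; rw [Function.update_self]; exact Fintype.mem_piFinset.1 (hPF ▸ hrepPF l₁ hl₁) i
    · rw [Function.update_of_ne hi]; exact Fintype.mem_piFinset.1 (hPF ▸ hrepPF l hl) i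
  have hPFupd2 : ∀ l ∈ S, ∀ l₁ ∈ S, ∀ l₂ ∈ S, ∀ j j',
      Function.update (Function.update (rep l) j (rep l₁ j)) j' (rep l₂ j') ∈ PF := by
    intro l hl l₁ hl₁ l₂ hl₂ j j'
    rw [hPF, Fintype.mem_piFinset]
    intro i
    by_cases hi : i = j'
    · subst hi; rw [Function.update_self]; exact Fintype.mem_piFinset.1 (hPF ▸ hrepPF l₂ hl₂) i
    · rw [Function.update_of_ne hi]
      exact Fintype.mem_piFinset.1 (hPF ▸ hPFupd l hl l₁ hl₁ j) i
  -- cancellation: if a tuple `a' ∈ PF` differs from `rep l` and is letterwise no lighter (with `rep l`'s letters or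
  -- letters of visible points), then `∏ û(a') = ∏ v̂(a')`
  have hcancel : ∀ l ∈ S, ∀ a' : Fin m → Expo, a' ∈ PF → a' ≠ rep l →
      (∀ i, a' i = 0 ∨ a' i ∈ T) → (∀ i, wt ζ (rep l i) ≤ wt ζ (a' i)) →
      ∏ j, hatCoeff (u j) (a' j) = ∏ j, hatCoeff (v j) (a' j) := by
    intro l hl a' ha' hne hT' hle
    have hge : wt (ξ l) l ≤ wt (ξ l) (∑ j, a' j) := by
      rw [hwt_rep (ξ l) l hl, wt_sum]
      exact Finset.sum_le_sum fun i _ => transfer l hl (a' i) (rep l i) (hT' i) (hletter l hl i) (hle i)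
    have hne' : (∑ j, a' j) ≠ l := by
      intro h
      have := hdis ha' (hrepPF l hl) (h.trans (hrepsum l hl).symm)
      exact hne this
    have hzero : coeff (∑ j, a' j) (tailDiff u v) = 0 := by
      by_contra h
      have hmem : (∑ j, a' j) ∈ ((tailDiff u v).support : Set Expo) := mem_support_iff.2 h
      have := (htopW l hl).2 _ hmem hne'
      exact absurd hge (not_le.2 this)
    rw [hcoeffW a' ha'] at hzero
    exact sub_eq_zero.1 hzero
  -- two visible points never dominate each other letterwise
  have hnodom : ∀ l ∈ S, ∀ l' ∈ S, l ≠ l' → ∃ j, wt ζ (rep l j) < wt ζ (rep l' j) := by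
    intro l hl l' hl' hne
    by_contra hno
    push Not at hno
    have hge : wt (ξ l') l' ≤ wt (ξ l') l := by
      rw [hwt_rep (ξ l') l hl, hwt_rep (ξ l') l' hl']
      exact Finset.sum_le_sum fun i _ => transfer l' hl' (rep l i) (rep l' i) (hletter l hl i) (hletter l' hl' i) (hno i)
    have := (htopW l' hl').2 l (hsupp l hl) hne
    exact absurd hge (not_le.2 this)
  -- the class count: for (f, g) = (u, v) or (v, u), points with `∏ f̂ ≠ 0` number at most `m + 1`
  have hclass : ∀ (f g : Fin m → MvPolynomial (Fin 2) ℂ), (f = u ∧ g = v) ∨ (f = v ∧ g = u) →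
      (S.filter fun l => ∏ j, hatCoeff (f j) (rep l j) ≠ 0).card ≤ m + 1 := by
    intro f g hfg
    set Sf := S.filter fun l => ∏ j, hatCoeff (f j) (rep l j) ≠ 0 with hSf
    have hSfS : ∀ l ∈ Sf, l ∈ S := fun l hl => by
      rw [hSf, Finset.mem_filter] at hl; exact hl.1
    have hSfne : ∀ l ∈ Sf, ∏ j, hatCoeff (f j) (rep l j) ≠ 0 := fun l hl => by
      rw [hSf, Finset.mem_filter] at hl; exact hl.2
    -- cancellation in the (f, g) form, and visibility in the (f, g) form
    have hcancel' : ∀ l ∈ S, ∀ a' : Fin m → Expo, a' ∈ PF → a' ≠ rep l →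
        (∀ i, a' i = 0 ∨ a' i ∈ T) → (∀ i, wt ζ (rep l i) ≤ wt ζ (a' i)) →
        ∏ j, hatCoeff (f j) (a' j) = ∏ j, hatCoeff (g j) (a' j) := by
      intro l hl a' ha' hne hT' hle
      rcases hfg with ⟨rfl, rfl⟩ | ⟨rfl, rfl⟩
      · exact hcancel l hl a' ha' hne hT' hle
      · exact (hcancel l hl a' ha' hne hT' hle).symm
    have hvis' : ∀ l ∈ S, ∏ j, hatCoeff (f j) (rep l j) ≠ ∏ j, hatCoeff (g j) (rep l j) := by
      intro l hl h
      have hne : coeff l (tailDiff u v) ≠ 0 := mem_support_iff.1 (hsupp l hl)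
      rw [← hrepsum l hl, hcoeffW _ (hrepPF l hl)] at hne
      rcases hfg with ⟨rfl, rfl⟩ | ⟨rfl, rfl⟩
      · exact hne (sub_eq_zero.2 h)
      · exact hne (sub_eq_zero.2 h.symm)
    -- improvable positions: at most one per point of the class
    have himp : ∀ l ∈ Sf, ∀ j j' : Fin m, ∀ l₁ ∈ Sf, ∀ l₂ ∈ Sf,
        wt ζ (rep l j) < wt ζ (rep l₁ j) → wt ζ (rep l j') < wt ζ (rep l₂ j') → j = j' := by
      intro l hl j j' l₁ hl₁ l₂ hl₂ hj hj'
      by_contra hjj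
      have hlS := hSfS l hl
      set a := rep l with ha
      set p := rep l₁ j with hp
      set p' := rep l₂ j' with hp'
      -- letters of the updated tuples are `0` or tail exponents, and no lighter than `a`'s
      have hT1 : ∀ i, Function.update a j p i = 0 ∨ Function.update a j p i ∈ T := by
        intro i; by_cases hi : i = j
        · subst hi; rw [Function.update_self]; exact hletter l₁ (hSfS l₁ hl₁) i
        · rw [Function.update_of_ne hi]; exact hletter l hlS i
      have hT2 : ∀ i, Function.update a j' p' i = 0 ∨ Function.update a j' p' i ∈ T := by
        intro i; by_cases hi : i = j'
        · subst hi; rw [Function.update_self]; exact hletter l₂ (hSfS l₂ hl₂) i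
        · rw [Function.update_of_ne hi]; exact hletter l hlS i
      have hT12 : ∀ i, Function.update (Function.update a j p) j' p' i = 0 ∨
          Function.update (Function.update a j p) j' p' i ∈ T := by
        intro i; by_cases hi : i = j'
        · subst hi; rw [Function.update_self]; exact hletter l₂ (hSfS l₂ hl₂) i
        · rw [Function.update_of_ne hi]; exact hT1 i
      have hle1 : ∀ i, wt ζ (a i) ≤ wt ζ (Function.update a j p i) := by
        intro i; by_cases hi : i = j
        · subst hi; rw [Function.update_self]; exact hj.le
        · rw [Function.update_of_ne hi]
      have hle2 : ∀ i, wt ζ (a i) ≤ wt ζ (Function.update a j' p' i) := by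
        intro i; by_cases hi : i = j'
        · subst hi; rw [Function.update_self]; exact hj'.le
        · rw [Function.update_of_ne hi]
      have hle12 : ∀ i, wt ζ (a i) ≤ wt ζ (Function.update (Function.update a j p) j' p' i) := by
        intro i; by_cases hi : i = j'
        · subst hi; rw [Function.update_self]; exact hj'.le
        · rw [Function.update_of_ne hi]; exact hle1 i
      have hne1 : Function.update a j p ≠ a := by
        intro h; have := congrFun h j; rw [Function.update_self] at this
        rw [this] at hj; exact lt_irrefl _ hj
      have hne2 : Function.update a j' p' ≠ a := by
        intro h; have := congrFun h j'; rw [Function.update_self] at this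
        rw [this] at hj'; exact lt_irrefl _ hj'
      have hne12 : Function.update (Function.update a j p) j' p' ≠ a := by
        intro h; have := congrFun h j'; rw [Function.update_self] at this
        rw [this] at hj'; exact lt_irrefl _ hj'
      -- the three cancellations
      have c1 := hcancel' l hlS _ (hPFupd l hlS l₁ (hSfS l₁ hl₁) j) hne1 hT1 hle1
      have c2 := hcancel' l hlS _ (hPFupd l hlS l₂ (hSfS l₂ hl₂) j') hne2 hT2 hle2
      have c12 := hcancel' l hlS _ (hPFupd2 l hlS l₁ (hSfS l₁ hl₁) l₂ (hSfS l₂ hl₂) j j') hne12 hT12 hle12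
      -- rank-one identities
      have idF := prod_mul_prod_update_update (fun i e => hatCoeff (f i) e) a hjj p p'
      have idG := prod_mul_prod_update_update (fun i e => hatCoeff (g i) e) a hjj p p'
      -- `F(a⁺ʲʲ') ≠ 0` inside the class
      have hF12 : ∏ i, hatCoeff (f i) (Function.update (Function.update a j p) j' p' i) ≠ 0 := by
        rw [Finset.prod_ne_zero_iff]
        intro i _
        by_cases hi : i = j'
        · subst hi; rw [Function.update_self]
          exact (Finset.prod_ne_zero_iff.1 (hSfne l₂ hl₂)) i (Finset.mem_univ _)
        · rw [Function.update_of_ne hi]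
          by_cases hi2 : i = j
          · subst hi2; rw [Function.update_self]
            exact (Finset.prod_ne_zero_iff.1 (hSfne l₁ hl₁)) i (Finset.mem_univ _)
          · rw [Function.update_of_ne hi2]
            exact (Finset.prod_ne_zero_iff.1 (hSfne l hl)) i (Finset.mem_univ _)
      -- conclude `F(a) = G(a)`
      apply hvis' l hlS
      have key : (∏ i, hatCoeff (f i) (a i) - ∏ i, hatCoeff (g i) (a i)) *
          ∏ i, hatCoeff (f i) (Function.update (Function.update a j p) j' p' i) = 0 := by
        rw [sub_mul, idF, c1, c2, ← idG, c12]
        ring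
      rcases mul_eq_zero.1 key with h | h
      · exact sub_eq_zero.1 h
      · exact absurd h hF12
    -- the injection into `Option (Fin m)`
    classical
    let Φ : Expo → Option (Fin m) := fun l =>
      if h : ∃ j : Fin m, ∃ l' ∈ Sf, wt ζ (rep l j) < wt ζ (rep l' j) then some (Classical.choose h) else none
    have hΦspec : ∀ l ∈ Sf, ∀ j, Φ l = some j → ∃ l' ∈ Sf, wt ζ (rep l j) < wt ζ (rep l' j) := by
      intro l _ j hj
      simp only [Φ] at hj
      split_ifs at hj with h
      · have := Classical.choose_spec h
        rw [Option.some.injEq] at hj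
        rwa [← hj]
    have hΦnone : ∀ l ∈ Sf, Φ l = none → ∀ j, ∀ l' ∈ Sf, ¬ wt ζ (rep l j) < wt ζ (rep l' j) := by
      intro l _ hnone j l' hl' hlt
      simp only [Φ] at hnone
      split_ifs at hnone with h
      exact h ⟨j, l', hl', hlt⟩
    have hinj : Set.InjOn Φ ↑Sf := by
      intro l hl l' hl' heq
      by_contra hne
      obtain ⟨j, hj⟩ := hnodom l (hSfS l hl) l' (hSfS l' hl') hne
      obtain ⟨j', hj'⟩ := hnodom l' (hSfS l' hl') l (hSfS l hl) (Ne.symm hne)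
      rcases hΦ : Φ l with _ | i
      · exact hΦnone l hl hΦ j l' hl' hj
      · obtain ⟨l₁, hl₁, hlt₁⟩ := hΦspec l hl i hΦ
        have hi : i = j := himp l hl i j l₁ hl₁ l' hl' hlt₁ hj
        rw [hΦ] at heq
        obtain ⟨l₂, hl₂, hlt₂⟩ := hΦspec l' hl' i heq.symm
        have hi' : i = j' := himp l' hl' i j' l₂ hl₂ l hl hlt₂ hj'
        rw [← hi] at hj; rw [← hi'] at hj'
        exact absurd (hj.trans hj') (lt_irrefl _)
    calc Sf.card ≤ (Finset.univ : Finset (Option (Fin m))).card :=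
          Finset.card_le_card_of_injOn Φ (fun _ _ => Finset.mem_univ _) hinj
      _ = m + 1 := by simp
  -- the two classes cover the cell
  have hcover : S ⊆ (S.filter fun l => ∏ j, hatCoeff (u j) (rep l j) ≠ 0) ∪
      (S.filter fun l => ∏ j, hatCoeff (v j) (rep l j) ≠ 0) := by
    intro l hl
    rw [Finset.mem_union, Finset.mem_filter, Finset.mem_filter]
    by_contra h
    push Not at h
    have hne : coeff l (tailDiff u v) ≠ 0 := mem_support_iff.1 (hsupp l hl)
    rw [← hrepsum l hl, hcoeffW _ (hrepPF l hl), h.1 hl, h.2 hl, sub_zero] at hne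
    exact hne rfl
  calc S.card ≤ ((S.filter fun l => ∏ j, hatCoeff (u j) (rep l j) ≠ 0) ∪
        (S.filter fun l => ∏ j, hatCoeff (v j) (rep l j) ≠ 0)).card := Finset.card_le_card hcover
    _ ≤ (S.filter fun l => ∏ j, hatCoeff (u j) (rep l j) ≠ 0).card +
        (S.filter fun l => ∏ j, hatCoeff (v j) (rep l j) ≠ 0).card := Finset.card_union_le _ _
    _ ≤ (m + 1) + (m + 1) := Nat.add_le_add (hclass u v (Or.inl ⟨rfl, rfl⟩)) (hclass v u (Or.inr ⟨rfl, rfl⟩))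
    _ = 2 * m + 2 := by ring

end Summit.ValiantsHypothesis.ValiantsHypothesis.Theorems.NewtonUnitEquations.TwoProducts.PlanarCell

end
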